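import Summits.CriticalPhenomena.SAWScalingLimit.Theorems.ConfinementPositivity.Negative.Cusp3Corridor

/-!
# `ConfinementPositivity` (stmt-CriticalPhenomena-17587) — negative knowledge, cusp series part 4: the detours

Refuter crux-attack support file (cdisprove).  The `4k - 1` two-row detours of the cusp witness,
`(1,0) → (1,-1) → … → (j,-1) → (j,-2) → … → (K,-2) → (K,-1) → (K,0)` (`K = 4k`, `1 ≤ j ≤ K-1`),
given through a vertex function `f j i` (`0 ≤ i ≤ K+3`) that enters every statement through its
defining hypothesis `hf` (no definition is added to the tree): values on the five legs
(`detour_val_*`), consecutive vertices are `ℤ²`-neighbours (`detour_zd_adj`), no repeated vertex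
(`detour_injOn`), interior vertices lie in columns `1 … K` of the rows `-1, -2`
(`detour_interior`), and two detours differ at position `j + 1` (`detour_ne`).  Also: every
vertex of a non-trivial walk of a discrete domain lies in it (`support_subset_meshDomain`).

Def-free helper; everything proved, standard axioms. [folklore]
-/

noncomputable section

namespace Summit.CriticalPhenomena.SAWScalingLimit.Theorems.ConfinementPositivity.Negative

open Set Metric Filter Topology Complex MeasureTheory
open scoped ENNReal
open Literature.Probability.RandomPlanarGeometry Literature.Probability.LatticeModels
open Summit.CriticalPhenomena.SAWScalingLimit.Theorems.ShellCrossingBound.Negative.Forcing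
  (meshPoint_vec vec_add_single_zero vec_add_single_one eq_vec)

/-! ### Vertices of a discrete-domain walk -/

/-- Every vertex of a walk of `Ω_δ` with at least one edge lies in the discrete domain.
[folklore] -/
theorem support_subset_meshDomain {Ω : Set ℂ} {δ : ℝ} {u v : Site 2}
    (p : (discreteDomainGraph Ω δ).Walk u v) (hp : 0 < p.length) :
    ∀ w ∈ p.support, w ∈ meshDomain Ω δ := by
  induction p with
  | nil => simp at hp
  | cons h q ih =>
    intro w hw
    rw [SimpleGraph.Walk.support_cons, List.mem_cons] at hw
    rcases hw with rfl | hw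
    · exact (discreteDomainGraph_adj_iff.1 h).2.1
    · cases q with
      | nil =>
        simp only [SimpleGraph.Walk.support_nil, List.mem_singleton] at hw
        subst hw
        exact (discreteDomainGraph_adj_iff.1 h).2.2
      | cons h' q' => exact ih (by simp) w hw

/-! ### The detours -/

section Detour

variable {K : ℕ} {f : ℕ → ℕ → Site 2}
  (hf : ∀ j i : ℕ, f j i = if i = 0 then ![1, 0] else if i ≤ j then ![(i : ℤ), -1]
    else if i ≤ K + 1 then ![(i : ℤ) - 1, -2] else if i = K + 2 then ![(K : ℤ), -1]
    else ![(K : ℤ), 0])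

include hf

/-- Start of a detour: `a_δ = (1, 0)`. [folklore] -/
theorem detour_val_zero (j : ℕ) : f j 0 = ![1, 0] := by rw [hf, if_pos rfl]

/-- First leg of a detour: row `-1`, columns `1 … j`. [folklore] -/
theorem detour_val_A {j i : ℕ} (h1 : 1 ≤ i) (h2 : i ≤ j) : f j i = ![(i : ℤ), -1] := by
  rw [hf, if_neg (by omega), if_pos h2]

/-- Second leg of a detour: row `-2`, columns `j … K`. [folklore] -/
theorem detour_val_B {j i : ℕ} (h1 : j < i) (h2 : i ≤ K + 1) : f j i = ![(i : ℤ) - 1, -2] := by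
  rw [hf, if_neg (by omega), if_neg (by omega), if_pos h2]

/-- Ascent of a detour: `(K, -1)`. [folklore] -/
theorem detour_val_C {j : ℕ} (hj : j + 1 ≤ K) : f j (K + 2) = ![(K : ℤ), -1] := by
  rw [hf, if_neg (by omega), if_neg (by omega), if_neg (by omega), if_pos rfl]

/-- End of a detour: the corridor end `(K, 0)`. [folklore] -/
theorem detour_val_D {j : ℕ} (hj : j + 1 ≤ K) : f j (K + 3) = ![(K : ℤ), 0] := by
  rw [hf, if_neg (by omega), if_neg (by omega), if_neg (by omega), if_neg (by omega)]

/-- Consecutive detour vertices are `ℤ²`-neighbours. [folklore] -/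
theorem detour_zd_adj {j : ℕ} (hj1 : 1 ≤ j) (hj : j + 1 ≤ K) {i : ℕ} (hi : i + 1 ≤ K + 3) :
    (zdGraph 2).Adj (f j i) (f j (i + 1)) := by
  rcases Nat.eq_zero_or_pos i with rfl | hipos
  · -- `(1,0) — (1,-1)`
    show (zdGraph 2).Adj (f j 0) (f j 1)
    rw [zdGraph_adj_iff, detour_val_zero hf, detour_val_A hf le_rfl hj1]
    refine ⟨1, Or.inr ?_⟩
    rw [vec_add_single_one]
    norm_num
  rw [zdGraph_adj_iff]
  rcases Nat.lt_or_ge i j with hij | hij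
  · -- along row `-1`
    refine ⟨0, Or.inl ?_⟩
    rw [detour_val_A hf hipos hij.le, detour_val_A hf (by omega) hij, vec_add_single_zero,
      Nat.cast_succ]
  rcases hij.eq_or_lt with rfl | hji
  · -- `(j,-1) — (j,-2)`
    refine ⟨1, Or.inr ?_⟩
    rw [detour_val_A hf hipos le_rfl, detour_val_B hf (Nat.lt_succ_self _) (by omega),
      vec_add_single_one, Nat.cast_succ]
    norm_num
  rcases Nat.lt_or_ge i (K + 1) with hiK | hiK
  · -- along row `-2`
    refine ⟨0, Or.inl ?_⟩
    rw [detour_val_B hf hji hiK.le, detour_val_B hf (by omega) hiK, vec_add_single_zero,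
      Nat.cast_succ]
    congr 1
    ring
  rcases hiK.eq_or_lt with h | h
  · -- `(K,-2) — (K,-1)`
    subst h
    refine ⟨1, Or.inl ?_⟩
    rw [detour_val_B hf hji le_rfl, detour_val_C hf hj, vec_add_single_one, Nat.cast_succ]
    norm_num
  · -- `(K,-1) — (K,0)`
    obtain rfl : i = K + 2 := by omega
    refine ⟨1, Or.inl ?_⟩
    rw [detour_val_C hf hj, detour_val_D hf hj, vec_add_single_one]
    norm_num

/-- The detour vertex function is injective on `[0, K+3]`. [folklore] -/
theorem detour_injOn {j : ℕ} (hj1 : 1 ≤ j) (hj : j + 1 ≤ K) {i₁ i₂ : ℕ} (h₁ : i₁ ≤ K + 3)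
    (h₂ : i₂ ≤ K + 3) (h : f j i₁ = f j i₂) : i₁ = i₂ := by
  rw [hf, hf] at h
  have h0 := congrFun h 0
  have h1 := congrFun h 1
  split_ifs at h0 h1 <;> simp at h0 h1 <;> omega

/-- Coordinates of the interior detour vertices: column in `[1, K]`, row `-1` or `-2`.
[folklore] -/
theorem detour_interior {j : ℕ} (hj1 : 1 ≤ j) (hj : j + 1 ≤ K) {i : ℕ} (hi1 : 1 ≤ i)
    (hi : i ≤ K + 2) :
    ∃ m n : ℤ, f j i = ![m, n] ∧ 1 ≤ m ∧ m ≤ K ∧ (n = -1 ∨ n = -2) := by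
  rcases Nat.lt_or_ge j i with hji | hij
  · rcases Nat.lt_or_ge (K + 1) i with hKi | hiK
    · obtain rfl : i = K + 2 := by omega
      exact ⟨K, -1, detour_val_C hf hj, by omega, le_rfl, Or.inl rfl⟩
    · exact ⟨(i : ℤ) - 1, -2, detour_val_B hf hji hiK, by omega, by omega, Or.inr rfl⟩
  · exact ⟨i, -1, detour_val_A hf hi1 hij, by omega, by omega, Or.inl rfl⟩

/-- Two different detours differ at position `j + 1` (row `-2` versus row `-1`). [folklore] -/
theorem detour_ne {j j' : ℕ} (hjj : j < j') (hj' : j' + 1 ≤ K) : f j (j + 1) ≠ f j' (j + 1) := by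
  rw [detour_val_B hf (Nat.lt_succ_self j) (by omega), detour_val_A hf (by omega) (by omega)]
  intro h
  have := congrFun h 1
  simp at this

end Detour

end Summit.CriticalPhenomena.SAWScalingLimit.Theorems.ConfinementPositivity.Negative

end
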